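import Mathlib.Algebra.Homology.DerivedCategory.Ext.ExactSequences
import Mathlib.CategoryTheory.Abelian.Exact
import Literature.Algebra.Homology.StaircaseTorsionFree
import HarnessLib

/-!
# `Ext` modulo powers: cohomology and base change `Extᵇ(A, X)/qᵉ ≅ Extᵇ(A, X/qᵉ X)`

The carrier-free algebraic core of the *coherent lattice lemmas* used in the `p`-adic deformation
of vector bundles / `K₀`-classes (X. Hu, arXiv:2507.12458, §11; Bloch–Esnault–Kerz, Rem. 35 (2),
[Hu2025TruncatedWitt], [BlochEsnaultKerz2014pAdic]): for a smooth projective `p`-adic formal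
scheme `𝒳` the transition maps `Hᵇ(𝒳, Ωʲ/p^{e+1}) → Hᵇ(𝒳, Ωʲ/p^{e})` are onto and
`Hᵇ(𝒳, Ωʲ/pᵉ) ≅ Hᵇ(𝒳, Ωʲ)/pᵉ` as soon as `H^{b+1}(𝒳, Ωʲ)` has no `p`-torsion. Abstractly: let `𝒜`
be an abelian category with `Ext`-groups (`HasExt`), `A X : 𝒜`, `m : ℤ` with `m • 𝟙 X` a
monomorphism ("`X` has no `m`-torsion"), so that `0 → X →(m • 𝟙) X → X/m → 0`
(`X/m := cokernel (m • 𝟙 X)`) is short exact (`shortExact_cokernel_of_mono`). Mathlib's covariant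
long exact `Ext`-sequence (`Ext.covariant_sequence_exact₂/₃`) together with the computation
`x ∘ [m • 𝟙 X] = m • x` (`Ext.comp_mk₀_zsmul_id`) gives, writing `π : X → X/m` for the projection
and `π_* : Extᵇ(A, X) → Extᵇ(A, X/m)` for post-composition:

* `Ext.zsmul_comp_extClass_eq_zero` — the Bockstein `δ z ∈ Ext^{b+1}(A, X)` of a class
  `z ∈ Extᵇ(A, X/m)` is killed by `m`;
* `Ext.postcomp_cokernelπ_surjective_of_torsionFree` — **right exactness**: if `Ext^{b+1}(A, X)`
  has no `m`-torsion then `π_*` is onto (variant `…_of_subsingleton` in top degree);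
* `Ext.comp_mk₀_cokernelπ_eq_zero_iff` — **kernel**: `π_* x = 0 ↔ x ∈ m • Extᵇ(A, X)`; together,
  `Extᵇ(A, X)/m ≅ Extᵇ(A, X/m)` ("cohomology and base change");
* `Ext.postcomp_surjective_of_cokernelπ_comp_eq` — **transitions are onto**: for any
  `ρ : X/m' → X/m` under `X` (it exists iff `m ∣ m'`, `exists_cokernelπ_comp_eq_of_dvd`),
  `ρ_* : Extᵇ(A, X/m') → Extᵇ(A, X/m)` is onto under the same torsion-freeness;
* `Ext.eq_zero_of_torsionFree` — **vanishing transfer**: `Extᵇ(A, X) = 0` and `Ext^{b+1}(A, X)`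
  without `m`-torsion (e.g. zero) force `Extᵇ(A, X/m) = 0`;

and the same package for `m = qᵉ` under the single hypothesis `Mono (q • 𝟙 X)` (section `Powers`,
using `mono_pow_smul_id` of `Algebra/Homology/StaircaseTorsionFree`), including the reduction
"no `q`-torsion ⇒ no `qᵉ`-torsion" (`eq_zero_of_int_pow_zsmul_eq_zero`, any `q : ℤ`; the case
`q = (p : ℕ)` is also in `Algebra/Homology/TorsionFreeLimitFamily`). Statements are elementwise /
`Function.Surjective`, ready for sheaf cohomology `Sheaf.H F n = Ext(ℤ, F) n`
(`Sheaf.H.map π n x = x.comp (Ext.mk₀ π) _` by `rfl`).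

[folklore] Everything is proved; no named facts; theorems only. Mathlib searched (pin v4.32):
`Ext.covariant_sequence_exact₁/₂/₃`, `ShortExact.extClass_comp`, `Ext.comp_mk₀_id`,
`Ext.bilinearComp`, `ShortComplex.exact_cokernel` (used); Mathlib has `Ext.comp_smul` only for an
`R`-linear structure (`Ext/Linear.lean`), not the plain `ℤ`-action used here. NOT here: the
packaging of kernel + image into an `AddEquiv` `Extᵇ(A, X)/m ≃+ Extᵇ(A, X/m)` (no definitions in
this file), Mittag-Leffler / inverse limits over `e`, and anything about sheaves or schemes.
-/

namespace Literature.Algebra.Homology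

open CategoryTheory CategoryTheory.Limits CategoryTheory.Abelian

universe w v u

variable {C : Type u} [Category.{v} C] [Abelian C]

/-! ### Short exactness of `0 → X →f Y → cokernel f → 0` and the reductions `X/m' → X/m` -/

/-- For a monomorphism `f : X ⟶ Y` in an abelian category, `0 → X →f Y → cokernel f → 0` is a
short exact sequence. [folklore] -/
theorem shortExact_cokernel_of_mono {X Y : C} (f : X ⟶ Y) [Mono f] :
    (ShortComplex.mk f (cokernel.π f) (cokernel.condition f)).ShortExact :=
  ShortComplex.ShortExact.mk' (ShortComplex.exact_cokernel f) inferInstance inferInstance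

/-- `(m • y) ≫ π = 0` for the projection `π : X → X/m`; more generally `(k m) • 𝟙 X` dies in
`X/m`. [folklore] -/
theorem mul_zsmul_id_comp_cokernelπ {X : C} (k m : ℤ) :
    ((k * m) • 𝟙 X) ≫ cokernel.π (m • 𝟙 X) = 0 := by
  rw [mul_smul, Preadditive.zsmul_comp, cokernel.condition, smul_zero]

/-- **The reduction `X/m' → X/m` exists when `m ∣ m'`**: there is a (unique, `cokernel.π` being
epi) morphism `ρ : cokernel (m' • 𝟙 X) ⟶ cokernel (m • 𝟙 X)` under `X`. [folklore] -/
theorem exists_cokernelπ_comp_eq_of_dvd {X : C} {m m' : ℤ} (h : m ∣ m') :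
    ∃ ρ : cokernel (m' • 𝟙 X) ⟶ cokernel (m • 𝟙 X),
      cokernel.π (m' • 𝟙 X) ≫ ρ = cokernel.π (m • 𝟙 X) := by
  obtain ⟨k, rfl⟩ := h
  exact ⟨cokernel.desc _ (cokernel.π (m • 𝟙 X)) (by rw [mul_comm, mul_zsmul_id_comp_cokernelπ]),
    cokernel.π_desc _ _ _⟩

/-- The reduction under `X` is unique: two morphisms `X/m' → T` agreeing after `cokernel.π` are
equal. [folklore] -/
theorem cokernel_hom_ext_of_π_comp_eq {X T : C} {m' : ℤ} (ρ ρ' : cokernel (m' • 𝟙 X) ⟶ T)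
    (h : cokernel.π (m' • 𝟙 X) ≫ ρ = cokernel.π (m' • 𝟙 X) ≫ ρ') : ρ = ρ' :=
  (cancel_epi (cokernel.π (m' • 𝟙 X))).mp h

/-- For `e ≤ e'` the reduction `X/qᵉ' → X/qᵉ` under `X` exists (`q ^ e ∣ q ^ e'`). [folklore] -/
theorem exists_cokernelπ_pow_comp_eq {X : C} (q : ℤ) {e e' : ℕ} (h : e ≤ e') :
    ∃ ρ : cokernel ((q ^ e' : ℤ) • 𝟙 X) ⟶ cokernel ((q ^ e : ℤ) • 𝟙 X),
      cokernel.π ((q ^ e' : ℤ) • 𝟙 X) ≫ ρ = cokernel.π ((q ^ e : ℤ) • 𝟙 X) :=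
  exists_cokernelπ_comp_eq_of_dvd (pow_dvd_pow q h)

/-- `0 → X →(qᵉ) X → X/qᵉ → 0` is short exact when `X` has no `q`-torsion (`q • 𝟙 X` mono).
[folklore] -/
theorem shortExact_cokernel_pow_smul_id {X : C} (q : ℤ) (e : ℕ) [Mono ((q : ℤ) • 𝟙 X)] :
    (ShortComplex.mk ((q ^ e : ℤ) • 𝟙 X) (cokernel.π ((q ^ e : ℤ) • 𝟙 X))
      (cokernel.condition _)).ShortExact :=
  haveI := mono_pow_smul_id (T := X) q e
  shortExact_cokernel_of_mono _

variable [HasExt.{w} C]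

/-! ### `ℤ`-bilinearity of `Ext.mk₀` and `Ext.comp` -/

section Bilinear

variable {A X Y : C} {a b c : ℕ}

/-- `Ext.mk₀` is `ℤ`-linear: `mk₀ (m • f) = m • mk₀ f`. [folklore] -/
theorem Ext.mk₀_zsmul (m : ℤ) (f : X ⟶ Y) : Ext.mk₀ (m • f) = m • Ext.mk₀ f :=
  map_zsmul (Ext.addEquiv₀ (X := X) (Y := Y)).symm m f

/-- `Ext.comp` is `ℤ`-linear in the second variable: `x ∘ (m • y) = m • (x ∘ y)`. [folklore] -/
theorem Ext.comp_zsmul (x : Ext A X a) (m : ℤ) (y : Ext X Y b) (h : a + b = c) :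
    x.comp (m • y) h = m • x.comp y h :=
  map_zsmul (Ext.bilinearComp A X Y a b c h x) m y

/-- `Ext.comp` is `ℤ`-linear in the first variable: `(m • x) ∘ y = m • (x ∘ y)`. [folklore] -/
theorem Ext.zsmul_comp (m : ℤ) (x : Ext A X a) (y : Ext X Y b) (h : a + b = c) :
    (m • x).comp y h = m • x.comp y h :=
  map_zsmul ((Ext.bilinearComp A X Y a b c h).flip y) m x

/-- `Ext.comp` is additive: `(x - x') ∘ y = x ∘ y - x' ∘ y`. [folklore] -/
theorem Ext.sub_comp (x x' : Ext A X a) (y : Ext X Y b) (h : a + b = c) :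
    (x - x').comp y h = x.comp y h - x'.comp y h :=
  map_sub ((Ext.bilinearComp A X Y a b c h).flip y) x x'

/-- `Ext.comp` is additive: `x ∘ (y - y') = x ∘ y - x ∘ y'`. [folklore] -/
theorem Ext.comp_sub (x : Ext A X a) (y y' : Ext X Y b) (h : a + b = c) :
    x.comp (y - y') h = x.comp y h - x.comp y' h :=
  map_sub (Ext.bilinearComp A X Y a b c h x) y y'

/-- **Post-composition with `m • 𝟙 X` is multiplication by `m`** on `Extᵇ(A, X)`:
`x ∘ [m • 𝟙 X] = m • x`. [folklore] -/
theorem Ext.comp_mk₀_zsmul_id (x : Ext A X b) (m : ℤ) :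
    x.comp (Ext.mk₀ (m • 𝟙 X)) (add_zero b) = m • x := by
  rw [Ext.mk₀_zsmul, Ext.comp_zsmul, Ext.comp_mk₀_id]

/-- Pre-composition with `m • 𝟙 A` is multiplication by `m` on `Extᵇ(A, X)`:
`[m • 𝟙 A] ∘ x = m • x`. [folklore] -/
theorem Ext.mk₀_zsmul_id_comp (m : ℤ) (x : Ext A X b) :
    (Ext.mk₀ (m • 𝟙 A)).comp x (zero_add b) = m • x := by
  rw [Ext.mk₀_zsmul, Ext.zsmul_comp, Ext.mk₀_id_comp]

end Bilinear

/-! ### `Ext` with values in `X/m` for `X` without `m`-torsion -/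

section Multiplier

variable {A X : C} (m : ℤ) {b : ℕ}

/-- A multiple `m • y` dies in `Extᵇ(A, X/m)`: `(m • y) ∘ [π] = 0` (as `(m • 𝟙 X) ≫ π = 0`; no
torsion hypothesis). [folklore] -/
theorem Ext.zsmul_comp_mk₀_cokernelπ (y : Ext A X b) :
    (m • y).comp (Ext.mk₀ (cokernel.π (m • 𝟙 X))) (add_zero b) = 0 := by
  rw [← Ext.comp_mk₀_zsmul_id, Ext.comp_assoc_of_second_deg_zero, Ext.mk₀_comp_mk₀,
    cokernel.condition, Ext.mk₀_zero, Ext.comp_zero]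

/-- **Compatibility of reductions**: if `ρ : X/m' → X/m` is a morphism under `X`
(`π' ≫ ρ = π`), then reducing a class to `X/m'` and pushing along `ρ` is reducing it to `X/m`:
`(x ∘ [π']) ∘ [ρ] = x ∘ [π]`. [folklore] -/
theorem Ext.comp_mk₀_cokernelπ_comp_mk₀_eq {m' : ℤ} (ρ : cokernel (m' • 𝟙 X) ⟶ cokernel (m • 𝟙 X))
    (hρ : cokernel.π (m' • 𝟙 X) ≫ ρ = cokernel.π (m • 𝟙 X)) (x : Ext A X b) :
    (x.comp (Ext.mk₀ (cokernel.π (m' • 𝟙 X))) (add_zero b)).comp (Ext.mk₀ ρ) (add_zero b) =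
      x.comp (Ext.mk₀ (cokernel.π (m • 𝟙 X))) (add_zero b) := by
  rw [Ext.comp_assoc_of_second_deg_zero, Ext.mk₀_comp_mk₀, hρ]

/-- **The Bockstein of a class mod `m` is `m`-torsion**: for the short exact sequence
`S : 0 → X →(m • 𝟙) X →(π) X/m → 0` and `z ∈ Extᵇ(A, X/m)`, the connecting class
`δ z = z ∘ [S] ∈ Ext^{b+1}(A, X)` satisfies `m • δ z = δ z ∘ [m • 𝟙 X] = z ∘ ([S] ∘ [S.f]) = 0`.
[folklore] -/
theorem Ext.zsmul_comp_extClass_eq_zero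
    (hS : (ShortComplex.mk (m • 𝟙 X) (cokernel.π (m • 𝟙 X)) (cokernel.condition _)).ShortExact)
    {c : ℕ} (h : b + 1 = c) (z : Ext A (cokernel (m • 𝟙 X)) b) :
    m • z.comp hS.extClass h = 0 := by
  rw [← Ext.comp_mk₀_zsmul_id, Ext.comp_assoc_of_third_deg_zero, hS.extClass_comp, Ext.comp_zero]

/-- If `Ext^{b+1}(A, X)` has no `m`-torsion, every Bockstein `δ z` (`z ∈ Extᵇ(A, X/m)`) vanishes.
[folklore] -/
theorem Ext.comp_extClass_eq_zero_of_torsionFree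
    (hS : (ShortComplex.mk (m • 𝟙 X) (cokernel.π (m • 𝟙 X)) (cokernel.condition _)).ShortExact)
    {c : ℕ} (h : b + 1 = c) (hX : ∀ y : Ext A X c, m • y = 0 → y = 0)
    (z : Ext A (cokernel (m • 𝟙 X)) b) : z.comp hS.extClass h = 0 :=
  hX _ (Ext.zsmul_comp_extClass_eq_zero m hS h z)

variable [Mono (m • 𝟙 X)]

/-- **Right exactness of reduction mod `m` on `Ext`.** If `X` has no `m`-torsion (`m • 𝟙 X` mono)
and `Ext^{b+1}(A, X)` has no `m`-torsion, then every class in `Extᵇ(A, X/m)` is the reduction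
`x ∘ [π]` of a class `x ∈ Extᵇ(A, X)`. [folklore] -/
theorem Ext.postcomp_cokernelπ_surjective_of_torsionFree
    (hX : ∀ y : Ext A X (b + 1), m • y = 0 → y = 0) :
    Function.Surjective
      (fun x : Ext A X b => x.comp (Ext.mk₀ (cokernel.π (m • 𝟙 X))) (add_zero b)) := fun z =>
  Ext.covariant_sequence_exact₃ A (shortExact_cokernel_of_mono (m • 𝟙 X)) z rfl
    (Ext.comp_extClass_eq_zero_of_torsionFree m _ rfl hX z)

/-- **Right exactness in top degree.** If `X` has no `m`-torsion and `Ext^{b+1}(A, X) = 0` (e.g.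
`b` is the cohomological dimension), `Extᵇ(A, X) → Extᵇ(A, X/m)` is onto. [folklore] -/
theorem Ext.postcomp_cokernelπ_surjective_of_subsingleton [Subsingleton (Ext A X (b + 1))] :
    Function.Surjective
      (fun x : Ext A X b => x.comp (Ext.mk₀ (cokernel.π (m • 𝟙 X))) (add_zero b)) :=
  Ext.postcomp_cokernelπ_surjective_of_torsionFree m fun y _ => Subsingleton.elim y 0

/-- **Kernel of reduction mod `m` on `Ext`.** If `X` has no `m`-torsion, a class `x ∈ Extᵇ(A, X)`
dies in `Extᵇ(A, X/m)` iff it is a multiple of `m`: `x ∘ [π] = 0 ↔ ∃ y, x = m • y`. With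
`Ext.postcomp_cokernelπ_surjective_of_torsionFree`: `Extᵇ(A, X)/m ≅ Extᵇ(A, X/m)` when
`Ext^{b+1}(A, X)` has no `m`-torsion ("cohomology and base change"). [folklore] -/
theorem Ext.comp_mk₀_cokernelπ_eq_zero_iff (x : Ext A X b) :
    x.comp (Ext.mk₀ (cokernel.π (m • 𝟙 X))) (add_zero b) = 0 ↔ ∃ y : Ext A X b, x = m • y := by
  refine ⟨fun hx => ?_, ?_⟩
  · obtain ⟨y, hy⟩ :=
      Ext.covariant_sequence_exact₂ A (shortExact_cokernel_of_mono (m • 𝟙 X)) x hx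
    exact ⟨y, by rw [← hy]; exact (Ext.comp_mk₀_zsmul_id y m)⟩
  · rintro ⟨y, rfl⟩
    exact Ext.zsmul_comp_mk₀_cokernelπ m y

/-- **Injectivity form of the kernel computation**: two classes of `Extᵇ(A, X)` with the same
reduction mod `m` differ by a multiple of `m`. [folklore] -/
theorem Ext.exists_eq_add_zsmul_of_comp_mk₀_cokernelπ_eq (x x' : Ext A X b)
    (h : x.comp (Ext.mk₀ (cokernel.π (m • 𝟙 X))) (add_zero b) =
      x'.comp (Ext.mk₀ (cokernel.π (m • 𝟙 X))) (add_zero b)) :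
    ∃ y : Ext A X b, x = x' + m • y := by
  obtain ⟨y, hy⟩ := (Ext.comp_mk₀_cokernelπ_eq_zero_iff m (x - x')).mp
    (by rw [Ext.sub_comp, h, sub_self])
  exact ⟨y, by rw [← hy, add_sub_cancel]⟩

/-- **Transition maps are onto.** If `X` and `Ext^{b+1}(A, X)` have no `m`-torsion, then for every
morphism `ρ : X/m' → X/m` under `X` (the reduction, `m ∣ m'`), post-composition
`ρ_* : Extᵇ(A, X/m') → Extᵇ(A, X/m)` is surjective: every class mod `m` lifts to `Extᵇ(A, X)`
and can be pushed to `X/m'`. [folklore] -/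
theorem Ext.postcomp_surjective_of_cokernelπ_comp_eq {m' : ℤ}
    (hX : ∀ y : Ext A X (b + 1), m • y = 0 → y = 0)
    (ρ : cokernel (m' • 𝟙 X) ⟶ cokernel (m • 𝟙 X))
    (hρ : cokernel.π (m' • 𝟙 X) ≫ ρ = cokernel.π (m • 𝟙 X)) :
    Function.Surjective
      (fun z : Ext A (cokernel (m' • 𝟙 X)) b => z.comp (Ext.mk₀ ρ) (add_zero b)) := by
  intro w
  obtain ⟨x, rfl⟩ := Ext.postcomp_cokernelπ_surjective_of_torsionFree m hX w
  exact ⟨x.comp (Ext.mk₀ (cokernel.π (m' • 𝟙 X))) (add_zero b),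
    Ext.comp_mk₀_cokernelπ_comp_mk₀_eq m ρ hρ x⟩

/-- **Vanishing transfer.** If `X` has no `m`-torsion, `Extᵇ(A, X) = 0` and `Ext^{b+1}(A, X)` has
no `m`-torsion, then `Extᵇ(A, X/m) = 0`. [folklore] -/
theorem Ext.eq_zero_of_torsionFree (hb : ∀ x : Ext A X b, x = 0)
    (hX : ∀ y : Ext A X (b + 1), m • y = 0 → y = 0) (z : Ext A (cokernel (m • 𝟙 X)) b) :
    z = 0 := by
  obtain ⟨x, rfl⟩ := Ext.postcomp_cokernelπ_surjective_of_torsionFree m hX z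
  simp only [hb x, Ext.zero_comp]

/-- **Vanishing transfer (both neighbours zero).** If `X` has no `m`-torsion and
`Extᵇ(A, X) = Ext^{b+1}(A, X) = 0`, then `Extᵇ(A, X/m) = 0`. [folklore] -/
theorem Ext.eq_zero_of_forall_eq_zero (hb : ∀ x : Ext A X b, x = 0)
    (hb' : ∀ y : Ext A X (b + 1), y = 0) (z : Ext A (cokernel (m • 𝟙 X)) b) : z = 0 :=
  Ext.eq_zero_of_torsionFree m hb (fun y _ => hb' y) z

/-- Subsingleton form of the vanishing transfer. [folklore] -/
theorem Ext.subsingleton_cokernel_of_subsingleton [Subsingleton (Ext A X b)]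
    [Subsingleton (Ext A X (b + 1))] : Subsingleton (Ext A (cokernel (m • 𝟙 X)) b) :=
  ⟨fun z z' => (Ext.eq_zero_of_forall_eq_zero m (fun x => Subsingleton.elim x 0)
    (fun y => Subsingleton.elim y 0) z).trans (Ext.eq_zero_of_forall_eq_zero m
      (fun x => Subsingleton.elim x 0) (fun y => Subsingleton.elim y 0) z').symm⟩

end Multiplier

/-! ### Powers `m = qᵉ` of a fixed `q` with `X` `q`-torsion-free -/

/-- **No `q`-torsion ⇒ no `qᵉ`-torsion** in an additive group. [folklore] -/
theorem eq_zero_of_int_pow_zsmul_eq_zero {M : Type*} [AddCommGroup M] {q : ℤ}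
    (hM : ∀ y : M, q • y = 0 → y = 0) (e : ℕ) (y : M) (hy : q ^ e • y = 0) : y = 0 := by
  induction e with
  | zero => rwa [pow_zero, one_smul] at hy
  | succ e ih =>
    rw [pow_succ', mul_smul] at hy
    exact ih (hM _ hy)

section Powers

variable {A X : C} (q : ℤ) (e : ℕ) {b : ℕ}

variable [Mono ((q : ℤ) • 𝟙 X)]

/-- **Right exactness mod `qᵉ`.** If `X` has no `q`-torsion and `Ext^{b+1}(A, X)` has no
`qᵉ`-torsion, `Extᵇ(A, X) → Extᵇ(A, X/qᵉ)` is onto. [folklore] -/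
theorem Ext.postcomp_cokernelπ_pow_surjective_of_torsionFree
    (hX : ∀ y : Ext A X (b + 1), (q ^ e : ℤ) • y = 0 → y = 0) :
    Function.Surjective
      (fun x : Ext A X b => x.comp (Ext.mk₀ (cokernel.π ((q ^ e : ℤ) • 𝟙 X))) (add_zero b)) :=
  haveI := mono_pow_smul_id (T := X) q e
  Ext.postcomp_cokernelπ_surjective_of_torsionFree (q ^ e) hX

/-- **Right exactness mod `qᵉ`, `q`-torsion-free form.** If `X` and `Ext^{b+1}(A, X)` have no
`q`-torsion, `Extᵇ(A, X) → Extᵇ(A, X/qᵉ)` is onto for every `e`. [folklore] -/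
theorem Ext.postcomp_cokernelπ_pow_surjective_of_torsionFree'
    (hX : ∀ y : Ext A X (b + 1), q • y = 0 → y = 0) :
    Function.Surjective
      (fun x : Ext A X b => x.comp (Ext.mk₀ (cokernel.π ((q ^ e : ℤ) • 𝟙 X))) (add_zero b)) :=
  Ext.postcomp_cokernelπ_pow_surjective_of_torsionFree q e (eq_zero_of_int_pow_zsmul_eq_zero hX e)

/-- **Right exactness mod `qᵉ` in top degree** (`Ext^{b+1}(A, X) = 0`). [folklore] -/
theorem Ext.postcomp_cokernelπ_pow_surjective_of_subsingleton [Subsingleton (Ext A X (b + 1))] :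
    Function.Surjective
      (fun x : Ext A X b => x.comp (Ext.mk₀ (cokernel.π ((q ^ e : ℤ) • 𝟙 X))) (add_zero b)) :=
  haveI := mono_pow_smul_id (T := X) q e
  Ext.postcomp_cokernelπ_surjective_of_subsingleton (q ^ e)

/-- **Kernel mod `qᵉ`**: for `X` without `q`-torsion, `x ∘ [π] = 0 ↔ ∃ y, x = qᵉ • y`; i.e.
`Extᵇ(A, X)/qᵉ ↪ Extᵇ(A, X/qᵉ)`. [folklore] -/
theorem Ext.comp_mk₀_cokernelπ_pow_eq_zero_iff (x : Ext A X b) :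
    x.comp (Ext.mk₀ (cokernel.π ((q ^ e : ℤ) • 𝟙 X))) (add_zero b) = 0 ↔
      ∃ y : Ext A X b, x = (q ^ e : ℤ) • y :=
  haveI := mono_pow_smul_id (T := X) q e
  Ext.comp_mk₀_cokernelπ_eq_zero_iff (q ^ e) x

/-- **Transition maps `Extᵇ(A, X/qᵉ') → Extᵇ(A, X/qᵉ)` are onto** for `X` without `q`-torsion
and `Ext^{b+1}(A, X)` without `qᵉ`-torsion, for any `ρ : X/qᵉ' → X/qᵉ` under `X`
(`exists_cokernelπ_pow_comp_eq`). [folklore] -/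
theorem Ext.postcomp_surjective_of_cokernelπ_pow_comp_eq {e' : ℕ}
    (hX : ∀ y : Ext A X (b + 1), (q ^ e : ℤ) • y = 0 → y = 0)
    (ρ : cokernel ((q ^ e' : ℤ) • 𝟙 X) ⟶ cokernel ((q ^ e : ℤ) • 𝟙 X))
    (hρ : cokernel.π ((q ^ e' : ℤ) • 𝟙 X) ≫ ρ = cokernel.π ((q ^ e : ℤ) • 𝟙 X)) :
    Function.Surjective
      (fun z : Ext A (cokernel ((q ^ e' : ℤ) • 𝟙 X)) b => z.comp (Ext.mk₀ ρ) (add_zero b)) :=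
  haveI := mono_pow_smul_id (T := X) q e
  Ext.postcomp_surjective_of_cokernelπ_comp_eq (q ^ e) hX ρ hρ

/-- **Transition maps are onto, `q`-torsion-free form**: `X` and `Ext^{b+1}(A, X)` without
`q`-torsion. [folklore] -/
theorem Ext.postcomp_surjective_of_cokernelπ_pow_comp_eq' {e' : ℕ}
    (hX : ∀ y : Ext A X (b + 1), q • y = 0 → y = 0)
    (ρ : cokernel ((q ^ e' : ℤ) • 𝟙 X) ⟶ cokernel ((q ^ e : ℤ) • 𝟙 X))
    (hρ : cokernel.π ((q ^ e' : ℤ) • 𝟙 X) ≫ ρ = cokernel.π ((q ^ e : ℤ) • 𝟙 X)) :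
    Function.Surjective
      (fun z : Ext A (cokernel ((q ^ e' : ℤ) • 𝟙 X)) b => z.comp (Ext.mk₀ ρ) (add_zero b)) :=
  Ext.postcomp_surjective_of_cokernelπ_pow_comp_eq q e (eq_zero_of_int_pow_zsmul_eq_zero hX e) ρ hρ

/-- **Vanishing transfer mod `qᵉ`**: `X` without `q`-torsion, `Extᵇ(A, X) = 0` and
`Ext^{b+1}(A, X)` without `qᵉ`-torsion give `Extᵇ(A, X/qᵉ) = 0`. [folklore] -/
theorem Ext.eq_zero_of_pow_torsionFree (hb : ∀ x : Ext A X b, x = 0)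
    (hX : ∀ y : Ext A X (b + 1), (q ^ e : ℤ) • y = 0 → y = 0)
    (z : Ext A (cokernel ((q ^ e : ℤ) • 𝟙 X)) b) : z = 0 :=
  haveI := mono_pow_smul_id (T := X) q e
  Ext.eq_zero_of_torsionFree (q ^ e) hb hX z

/-- **Vanishing transfer mod `qᵉ` (both neighbours zero)**: `X` without `q`-torsion and
`Extᵇ(A, X) = Ext^{b+1}(A, X) = 0` give `Extᵇ(A, X/qᵉ) = 0` for every `e`. [folklore] -/
theorem Ext.eq_zero_of_pow_forall_eq_zero (hb : ∀ x : Ext A X b, x = 0)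
    (hb' : ∀ y : Ext A X (b + 1), y = 0) (z : Ext A (cokernel ((q ^ e : ℤ) • 𝟙 X)) b) :
    z = 0 :=
  haveI := mono_pow_smul_id (T := X) q e
  Ext.eq_zero_of_forall_eq_zero (q ^ e) hb hb' z

end Powers

end Literature.Algebra.Homology
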